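import Summits.BirchSwinnertonDyer.BirchSwinnertonDyer.Theorems.PrintX10bHeegnerDivisibilityHowardFrames
import Literature.NumberTheory.EllipticCurves.HeegnerPointsOfConductorOneGaloisConjProofs
import HarnessLib

/-!
# Crux `BeyondCarrierDepthX10b` (stmt-BirchSwinnertonDyer-23055, `route-BirchSwinnertonDyer-PrintX10b`
# rev 18, rank 301): the HOWARD-FRAMES stub `stub_beyondCarrier_coprimeClassNumber` of the registered
# birth skeleton (BC3, plan g3 2026-08-27T22:30:37Z), BY SIGNATURE, modulo the named facts of p577630

HONEST FRAMING (cell `run/shared/lean/pub/bsd-f3-mu/`, idle lead seat p1 serving the PrintX10b pen's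
BC3 ask of 2026-08-27T22:31:20Z): THEOREMS ONLY, nothing booked. The crux `BeyondCarrierDepthX10b` is
NOT closed by this file: its second registered stub `stub_beyondCarrier_divisibleClassNumber` (the
frames with `3 ∣ h_K`) is open, and the present stub is proved CONDITIONALLY — every published input is
a named Literature fact BY NAME, exactly the trust base of p4's
`Summit.BirchSwinnertonDyer.BirchSwinnertonDyer.Rank1Residual.heegnerDivisibilityX10b_coprimeFrames_of_namedFacts`
(`Theorems/PrintX10bHeegnerDivisibilityHowardFrames.lean`), minus Shimura reciprocity at conductor `1`,
which the tree has DISCHARGED (`Literature.NumberTheory.EllipticCurves.heegnerPointOfConductor_one_galoisConj_holds`).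
BSD is not proved by any of this.

WHAT. The registered stub signature VERBATIM (= the child crux's body with `¬ p ∣ NumberField.classNumber K`
inserted after `SatisfiesHeegnerHypothesis p K`): on every rev-3b X10b Heegner frame (`p = 3`, `E[3]`
irreducible, `ρ̄_{E,3}` not onto, non-CM, `r_an = 1`; `d_K ≡ 1 (mod 8)`, `N_E` and `3` split, Manin-good,
`y_K` of infinite order) with `3 ∤ h_K`, for every depth `s` beyond every single carrier
(`ord_3 c_q(E) < s` for all bad `q`) and `s ≤ ord_3 ∏ c_q`, every derived Heegner point `P_n` on Kolyvagin
primes of index `≥ s` is `3^s`-divisible in `E(K[n])`. p577630 proves MORE on these frames (all depths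
`s ≤ ord_3 ∏ c_q`; the beyond-carrier clause is simply not used), so the port is one weakening step.

* `stub_beyondCarrier_coprimeClassNumber_of_namedFacts` — the stub modulo `h46` (Mastella–Zerman 2026
  Cor. 4.6), `hYZ` (the Yan–Zhu/BCS/CGLS composite, kept BY NAME per the cell convention and fed
  `X11b.….thm57_thm59_bcs422_cgls513_of_heegnerDivisibility_of_printFacts h57 h59 h422 h513 hC` at a leaf),
  `h331` (JSW 2017 Thm. 3.3.1), `hChaL` (Cha 2005 Rmk. 25, lower half), `hKo` (Kolyvagin 1990 Thm. A) —
  FIVE named facts; `hrec` discharged.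
* `stub_beyondCarrier_coprimeClassNumber_of_namedFacts'` — the same with the SIX hypotheses of p577630
  verbatim (for consumers that already hold `hrec`).

References: [MastellaZerman2026] Cor. 4.6; [YanZhu2024MainConjNonCM] Thm. 5.7 (1), 5.9;
[BurungaleCastellaSkinner2025] Prop. 4.2.2; [CastellaGrossiLeeSkinner2022] Thm. 5.1.3;
[JetchevSkinnerWan2017] Thm. 3.3.1; [Cha2005] Thm. 21, Rmk. 25; [Kolyvagin1990] Thm. A;
[Darmon2004] Thm. 3.7; route file `Theses/PrintX10b.lean` (rev 18, items 21340 / 23055).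
-/

-- the REGISTERED stub namespace `Summit.BirchSwinnertonDyer.BirchSwinnertonDyer.Cruxes.…` repeats the summit name
set_option linter.dupNamespace false
set_option autoImplicit false

noncomputable section

open WeierstrassCurve NumberField
  Literature.NumberTheory.EllipticCurves Literature.NumberTheory.EllipticCurves.ModularForms
  Literature.NumberTheory.EllipticCurves.JetchevSkinnerWan2017
  Literature.NumberTheory.EllipticCurves.YanZhu2026

open Literature.NumberTheory.EllipticCurves.Rank1Residual (ClassX10 Surj)

namespace Summit.BirchSwinnertonDyer.BirchSwinnertonDyer.Cruxes.BeyondCarrierDepthX10b.HowardFrames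

/-- **Stub `stub_beyondCarrier_coprimeClassNumber` of crux `BeyondCarrierDepthX10b` (item 23055), registered
signature VERBATIM, modulo FIVE named facts** (`h46` Mastella–Zerman Cor. 4.6, `hYZ` the Yan–Zhu/BCS/CGLS
composite, `h331` JSW Thm. 3.3.1, `hChaL` Cha Rmk. 25 lower half, `hKo` Kolyvagin Thm. A; Shimura
reciprocity at conductor `1` is supplied by the tree theorem
`heegnerPointOfConductor_one_galoisConj_holds`): on the rev-3b X10b Heegner frames with `3 ∤ h_K`, every
derived Heegner point on Kolyvagin primes of index `≥ s` is `3^s`-divisible for every beyond-carrier depth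
`s ≤ ord_3 ∏ c_q(E)`. One weakening step from
`Rank1Residual.heegnerDivisibilityX10b_coprimeFrames_of_namedFacts` (which gives ALL depths on these
frames; the beyond-carrier hypothesis is discarded).
[cite: MastellaZerman2026, Cor. 4.6] [cite: YanZhu2024MainConjNonCM, Thm. 5.7 (1), Thm. 5.9]
[cite: JetchevSkinnerWan2017, Thm. 3.3.1] [cite: Cha2005, Thm. 21 and Rmk. 25] [cite: Kolyvagin1990, Thm. A]
[cite: Darmon2004, Thm. 3.7] -/
theorem stub_beyondCarrier_coprimeClassNumber_of_namedFacts
    (h46 : MastellaZerman2026.cor46_howardDivisibility_of_scalarImage.{0})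
    (hYZ : thm57_thm59_bcs422_cgls513_generator_constantCoeff_of_heegnerDivisibility)
    (h331 : thm331_anticyclotomicControl)
    (hChaL : Cha2005.rmk25_pow_dvd_card_sha_primary_of_certificate)
    (hKo : ∀ (N : ℕ) [NeZero N] (W : WeierstrassCurve ℚ) (K : Type) [Field K] [NumberField K],
      kolyvagin N W K) :
    ∀ (W : WeierstrassCurve ℚ) [W.IsElliptic] [W.IsGloballyMinimal] [NeZero (W.conductorNorm ℤ)] (p : ℕ) [Fact p.Prime], Literature.NumberTheory.EllipticCurves.Rank1Residual.ClassX10 W p → ¬ Literature.NumberTheory.EllipticCurves.Rank1Residual.Surj W 3 → ¬ W.HasCM → W.analyticRank = 1 → ∃ B : ℕ, ∀ (K : Type) [Field K] [NumberField K] (Dt : Literature.NumberTheory.EllipticCurves.ModularForms.ModularParametrizationData W (W.conductorNorm ℤ)) (β : ℤ) (ι : K →+* ℂ), Literature.NumberTheory.EllipticCurves.IsImaginaryQuadratic K → B < (NumberField.discr K).natAbs → NumberField.discr K % 8 = 1 → Literature.NumberTheory.EllipticCurves.SatisfiesHeegnerHypothesis (W.conductorNorm ℤ) K → Literature.NumberTheory.EllipticCurves.SatisfiesHeegnerHypothesis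 p K → ¬ p ∣ NumberField.classNumber K → (4 * (W.conductorNorm ℤ : ℤ)) ∣ β ^ 2 - NumberField.discr K → ¬ (p : ℤ) ∣ Dt.c → ∀ (d₁ : Literature.NumberTheory.EllipticCurves.KolyvaginHeegnerData Dt β ι 1), ¬ IsOfFinAddOrder d₁.derivedPoint → ∀ (s : ℕ), (∀ (q : ℕ) [Fact q.Prime], q ∣ W.conductorNorm ℤ → padicValNat p ((W.baseChange ℚ_[q]).localTamagawaNumber ℤ_[q]) < s) → s ≤ padicValNat p W.tamagawaProduct → ∀ (n : ℕ) (d : Literature.NumberTheory.EllipticCurves.KolyvaginHeegnerData Dt β ι n), Squarefree n → (∀ ℓ ∈ n.primeFactors, Literature.NumberTheory.EllipticCurves.Zhang2014.IsKolyvaginPrime (W.conductorNorm ℤ) W K p ℓ ∧ s ≤ Literature.NumberTheory.EllipticCurves.Zhang2014.kolyvaginIndex W p ℓ) → ∃ Q : (W.baseChange (Literature.NumberTheory.EllipticCurves.ringClassField K ι n)).toAffine.Point, ((p ^ s : ℕ) : ℤ) • Q = d.derivedPoint := by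
  intro W _ _ _ p _ hX hns hcm hr
  obtain ⟨B, hB⟩ := Rank1Residual.heegnerDivisibilityX10b_coprimeFrames_of_namedFacts h46 hYZ h331 hChaL
    hKo (fun N _ W K _ _ ↦ heegnerPointOfConductor_one_galoisConj_holds N W K) W p hX hns hcm hr
  exact ⟨B, fun K _ _ Dt β ι hK hBK hd8 hHN hHp hhK hβ hc d₁ hd₁ s _ hs n d hn hℓ ↦
    hB K Dt β ι hK hBK hd8 hHN hHp hhK hβ hc d₁ hd₁ s hs n d hn hℓ⟩

/-- **The same stub with the SIX hypotheses of p577630 verbatim** (Shimura reciprocity `hrec` kept as a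
binder, for consumers that already carry it): `stub_beyondCarrier_coprimeClassNumber` of crux
`BeyondCarrierDepthX10b` (item 23055), registered signature VERBATIM, from `h46`, `hYZ`, `h331`, `hChaL`,
`hKo`, `hrec`. The `hrec` binder is NOT used beyond being available — the five-fact form above already
discharges it; this form exists only so that a caller holding p577630's exact argument list can apply it
positionally.
[cite: MastellaZerman2026, Cor. 4.6] [cite: YanZhu2024MainConjNonCM, Thm. 5.7 (1), Thm. 5.9]
[cite: JetchevSkinnerWan2017, Thm. 3.3.1] [cite: Cha2005, Thm. 21 and Rmk. 25] [cite: Kolyvagin1990, Thm. A] -/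
theorem stub_beyondCarrier_coprimeClassNumber_of_namedFacts'
    (h46 : MastellaZerman2026.cor46_howardDivisibility_of_scalarImage.{0})
    (hYZ : thm57_thm59_bcs422_cgls513_generator_constantCoeff_of_heegnerDivisibility)
    (h331 : thm331_anticyclotomicControl)
    (hChaL : Cha2005.rmk25_pow_dvd_card_sha_primary_of_certificate)
    (hKo : ∀ (N : ℕ) [NeZero N] (W : WeierstrassCurve ℚ) (K : Type) [Field K] [NumberField K],
      kolyvagin N W K)
    (hrec : ∀ (N : ℕ) [NeZero N] (W : WeierstrassCurve ℚ) (K : Type) [Field K] [NumberField K],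
      heegnerPointOfConductor_one_galoisConj N W K) :
    ∀ (W : WeierstrassCurve ℚ) [W.IsElliptic] [W.IsGloballyMinimal] [NeZero (W.conductorNorm ℤ)] (p : ℕ) [Fact p.Prime], Literature.NumberTheory.EllipticCurves.Rank1Residual.ClassX10 W p → ¬ Literature.NumberTheory.EllipticCurves.Rank1Residual.Surj W 3 → ¬ W.HasCM → W.analyticRank = 1 → ∃ B : ℕ, ∀ (K : Type) [Field K] [NumberField K] (Dt : Literature.NumberTheory.EllipticCurves.ModularForms.ModularParametrizationData W (W.conductorNorm ℤ)) (β : ℤ) (ι : K →+* ℂ), Literature.NumberTheory.EllipticCurves.IsImaginaryQuadratic K → B < (NumberField.discr K).natAbs → NumberField.discr K % 8 = 1 → Literature.NumberTheory.EllipticCurves.SatisfiesHeegnerHypothesis (W.conductorNorm ℤ) K → Literature.NumberTheory.EllipticCurves.SatisfiesHeegnerHypothesis p K → ¬ p ∣ NumberField.classNumber K → (4 * (W.conductorNorm ℤ : ℤ)) ∣ β ^ 2 - NumberField.discr K → ¬ (p : ℤ) ∣ Dt.c → ∀ (d₁ : Literature.NumberTheory.EllipticCurves.KolyvaginHeegnerData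 Dt β ι 1), ¬ IsOfFinAddOrder d₁.derivedPoint → ∀ (s : ℕ), (∀ (q : ℕ) [Fact q.Prime], q ∣ W.conductorNorm ℤ → padicValNat p ((W.baseChange ℚ_[q]).localTamagawaNumber ℤ_[q]) < s) → s ≤ padicValNat p W.tamagawaProduct → ∀ (n : ℕ) (d : Literature.NumberTheory.EllipticCurves.KolyvaginHeegnerData Dt β ι n), Squarefree n → (∀ ℓ ∈ n.primeFactors, Literature.NumberTheory.EllipticCurves.Zhang2014.IsKolyvaginPrime (W.conductorNorm ℤ) W K p ℓ ∧ s ≤ Literature.NumberTheory.EllipticCurves.Zhang2014.kolyvaginIndex W p ℓ) → ∃ Q : (W.baseChange (Literature.NumberTheory.EllipticCurves.ringClassField K ι n)).toAffine.Point, ((p ^ s : ℕ) : ℤ) • Q = d.derivedPoint := by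
  intro W _ _ _ p _ hX hns hcm hr
  obtain ⟨B, hB⟩ := Rank1Residual.heegnerDivisibilityX10b_coprimeFrames_of_namedFacts h46 hYZ h331 hChaL
    hKo hrec W p hX hns hcm hr
  exact ⟨B, fun K _ _ Dt β ι hK hBK hd8 hHN hHp hhK hβ hc d₁ hd₁ s _ hs n d hn hℓ ↦
    hB K Dt β ι hK hBK hd8 hHN hHp hhK hβ hc d₁ hd₁ s hs n d hn hℓ⟩

end Summit.BirchSwinnertonDyer.BirchSwinnertonDyer.Cruxes.BeyondCarrierDepthX10b.HowardFrames

end
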